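import Summits.CriticalPhenomena.PercolationContinuityZ3.Theorems.PercNearOneGluingNoHeavyRsw3VolumeBallFamily
import Summits.CriticalPhenomena.PercolationContinuityZ3.Theorems.PercNearOneGluingNoHeavyRsw3VolumeNearestNeighbour
import Summits.CriticalPhenomena.PercolationContinuityZ3.Theorems.PercNearOneGluingNoHeavyRsw3VolumeThreeBall
import HarnessLib

/-!
# RSW3 lane (P2, gen 21): KESTEN'S THEOREM (8) IN ALL MOMENTS, III — the lattice sums of nearest-neighbour weights by induction
# on the number of points (every `p`, under the one-arm ratio inequalities (R1), (R2), (R_lin))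

builds on p205010 (kernel theorem, internal audit signed; external expert review pending) — NOT used in this file.

Cell `prim-rsw3`, prover seat `prim-rsw3-p2` (gen 21), memo `run/shared/lean/prim/rsw3/P2-RSWLITE.md` §28.
Support file (`--supports stmt-CriticalPhenomena-4575`); no definitions, no named facts, no sorries.

Write `π(k) = π_p(k)`, `s(n) = n^d π(n)`, `δ⟦S, x⟧` = nearest-neighbour distance of `x` in `S` (part II, inline), and
`W(S) = ∏_{x ∈ S} π(⌊(δ⟦S,x⟧ − 1)/2⌋)` (the product of the one-arm probabilities at the nearest-neighbour radii; by part I,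
`P_p(⋂_{x ∈ S} {0 ↔ x}) ≤ W(S)`).  Hypotheses, all consequences of (A2)□ at `p_c(ℤ^d)` (gens 19–20) and true on `ℤ²` at `1/2`:
(R1) `π(j)²(j/(16n))^{d−1} ≤ Aπ(n)²`, (R_lin) `π(j)(j/(4n))^{d−1} ≤ A'π(n)` (`1 ≤ j ≤ n`), (R2) `π(j) ≤ Bπ(n)` (`1 ≤ j ≤ n ≤ 8j`),
`π(1) > 0`, `p > 0`.

* §1 `oneArmProb_halfRadius_doubling` — (R2) makes `m ↦ π(⌊(m−1)/2⌋)` a doubling weight: `f(u) ≤ (B/π(1))·f(v)` for `u ≤ v ≤ 2u`;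
* §2 `sum_pairWeight_le` — the inner sum of the insertion inequality:
  `Σ_{a ∈ Λ(n)} f(‖a−b‖)·f(min(‖a−b‖, R))/f(R) ≤ K · s(n)` for `b ∈ Λ(n)`, `R ≤ 4n+1` (gen 19's `π²` lattice sum + gen 20's linear sum);
* §3 `sum_prod_insert_le_mul` — ONE MORE POINT COSTS A FACTOR `s(n)`: for `0 ∈ S ⊆ Λ(n)` (any `S`),
  `Σ_{a ∈ Λ(n)} W(S ∪ {a}) ≤ M_{|S|} · s(n) · W(S)`; the singleton case `Σ_a W({0, a}) ≤ K₁ s(n) π(n)` (`sum_prod_insert_singleton_le`);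
* §4 `exists_sum_piFinset_weight_le` — by induction on `t`, for tuples `q : Fin (t+1) → Λ(n)` and `S(q) = {0} ∪ range q`:
  **`Σ_q W(S(q)) ≤ C_t · s(n)^{t+1} · π(n)`** — the lattice-sum half of `E|C(0) ∩ Λ(n)|^{t+1} ≤ C_t s(n)^{t+1} π(n)`.

References: H. Kesten, Probab. Theory Relat. Fields 73 (1986) 369–394, Thm. (8), (46)–(53), footnote 5 (Nguyen's induction)
[Kesten1986]; C. Borgs, J. Chayes, H. Kesten, J. Spencer, Random Structures Algorithms 15 (1999), §1 [BorgsChayesKestenSpencer1999].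
[folklore]
-/

noncomputable section

namespace Summit.CriticalPhenomena.PercolationContinuityZ3.Theorems

namespace Rsw3

open MeasureTheory Literature.Probability.LatticeModels Literature.Probability.Percolation
open SurfaceTension Crossing SimpleGraph Finset
open Literature.Barriers.CriticalPhenomena (sub_mem_box_two_mul)

variable {d : ℕ}


/-! ## §1 The half-radius one-arm weight is a doubling weight under (R2) -/

/-- **(R2) ⇒ doubling of the weight `m ↦ π(⌊(m−1)/2⌋)`**: for `u ≤ v ≤ 2u`,
`π(⌊(u−1)/2⌋) ≤ (B/π(1)) · π(⌊(v−1)/2⌋)` (for `u ≥ 3` the radii are within ratio `8`; for `u ≤ 2` the left side is `π(0) = 1` and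
the right radius is `≤ 1`). [cite: Kesten1986, Thm. (8), (38)] -/
theorem oneArmProb_halfRadius_doubling (p : unitInterval) {B : ℝ}
    (hR2 : ∀ j n : ℕ, 1 ≤ j → j ≤ n → n ≤ 8 * j → oneArmProb d p j ≤ B * oneArmProb d p n)
    (hπ1 : 0 < oneArmProb d p 1) {u v : ℕ} (huv : u ≤ v) (hvu : v ≤ 2 * u) :
    oneArmProb d p ((u - 1) / 2) ≤ B / oneArmProb d p 1 * oneArmProb d p ((v - 1) / 2) := by
  have hB1 : 1 ≤ B := by
    have h := hR2 1 1 le_rfl le_rfl (by norm_num)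
    nlinarith
  have hπle1 : oneArmProb d p 1 ≤ 1 := measureReal_le_one
  have hBD : B ≤ B / oneArmProb d p 1 := by
    rw [le_div_iff₀ hπ1]; nlinarith
  have hπv0 : 0 ≤ oneArmProb d p ((v - 1) / 2) := measureReal_nonneg
  by_cases hj : 1 ≤ (u - 1) / 2
  · calc oneArmProb d p ((u - 1) / 2) ≤ B * oneArmProb d p ((v - 1) / 2) :=
          hR2 _ _ hj (Nat.div_le_div_right (Nat.sub_le_sub_right huv 1)) (by omega)
      _ ≤ B / oneArmProb d p 1 * oneArmProb d p ((v - 1) / 2) := mul_le_mul_of_nonneg_right hBD hπv0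
  · have hu : (u - 1) / 2 = 0 := by omega
    have hv1 : (v - 1) / 2 ≤ 1 := by omega
    rw [hu]
    have h1 : oneArmProb d p 1 ≤ oneArmProb d p ((v - 1) / 2) := DCT16.real_siteToBoundary_antitone p hv1
    have h0 : oneArmProb d p 0 ≤ 1 := measureReal_le_one
    calc oneArmProb d p 0 ≤ 1 := h0
      _ ≤ B := hB1
      _ = B / oneArmProb d p 1 * oneArmProb d p 1 := by field_simp
      _ ≤ B / oneArmProb d p 1 * oneArmProb d p ((v - 1) / 2) :=
          mul_le_mul_of_nonneg_left h1 (div_nonneg (by linarith) hπ1.le)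

/-! ## §2 The inner sum of the insertion inequality -/

/-- A nonnegative function of the difference `a − b`, summed over `a ∈ Λ(n)` (`b ∈ Λ(n)`), is at most its sum over `Λ(2n)`. [folklore] -/
theorem sum_box_sub_le_sum_box_two_mul {n : ℕ} {b : Site d} (hb : b ∈ box d n) {g : Site d → ℝ} (hg : ∀ z, 0 ≤ g z) :
    ∑ a ∈ box d n, g (a - b) ≤ ∑ z ∈ box d (2 * n), g z := by
  classical
  have hinj : Set.InjOn (fun a : Site d => a - b) ↑(box d n) := fun x _ y _ h => sub_left_injective h
  rw [← Finset.sum_image hinj]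
  refine Finset.sum_le_sum_of_subset_of_nonneg ?_ fun z _ _ => hg z
  intro z hz
  rw [Finset.mem_image] at hz
  obtain ⟨a, ha, rfl⟩ := hz
  exact sub_mem_box_two_mul ha hb

/-- **The inner sum** (every `p > 0`, `d ≥ 1`, (R1), (R_lin), `π(1) > 0`): for `n ≥ 1`, `b ∈ Λ(n)` and `R ≤ 4n + 1`,
`Σ_{a ∈ Λ(n)} π(⌊(‖a−b‖−1)/2⌋) · π(⌊(min(‖a−b‖,R)−1)/2⌋)/π(⌊(R−1)/2⌋) ≤ K · n^d · π(n)`,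
`K = 2^d (C₂ + C₁)` with the constants `C₂` of gen 19's `π²` lattice sum and `C₁` of gen 20's linear lattice sum: each term is at most
`π(k_a)²/π(⌊(R−1)/2⌋) + π(k_a)` (`k_a = ⌊(‖a−b‖−1)/2⌋`), `π(⌊(R−1)/2⌋) ≥ π(2n)`, and `Σ_{Λ(2n)} π(k)² ≤ C₂(2n)^dπ(2n)²`,
`Σ_{Λ(2n)} π(k) ≤ C₁(2n)^dπ(2n)`. [cite: Kesten1986, Thm. (8), (52)–(53)] -/
theorem sum_pairWeight_le (hd : 1 ≤ d) (p : unitInterval) (hp : 0 < (p : ℝ)) {A A' : ℝ} (hA : 0 ≤ A) (hA' : 0 ≤ A')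
    (hR1 : ∀ j n : ℕ, 1 ≤ j → j ≤ n →
      oneArmProb d p j ^ 2 * ((j : ℝ) / (16 * n)) ^ (d - 1) ≤ A * oneArmProb d p n ^ 2)
    (hRlin : ∀ j n : ℕ, 1 ≤ j → j ≤ n →
      oneArmProb d p j * ((j : ℝ) / (4 * n)) ^ (d - 1) ≤ A' * oneArmProb d p n)
    (hπ1 : 0 < oneArmProb d p 1) {n : ℕ} (hn : 1 ≤ n) {b : Site d} (hb : b ∈ box d n) {R : ℕ} (hR : R ≤ 4 * n + 1) :
    ∑ a ∈ box d n, oneArmProb d p ((Site.supNorm (a - b) - 1) / 2) *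
        (oneArmProb d p ((min (Site.supNorm (a - b)) R - 1) / 2) / oneArmProb d p ((R - 1) / 2)) ≤
      (2 : ℝ) ^ d * ((2 * d * A * (192 : ℝ) ^ (d - 1) + (5 : ℝ) ^ d * (A * (16 : ℝ) ^ (d - 1) / oneArmProb d p 1 ^ 2)) +
        (2 * d * A' * (48 : ℝ) ^ (d - 1) + (5 : ℝ) ^ d * (A' * (4 : ℝ) ^ (d - 1) / oneArmProb d p 1))) *
        (n : ℝ) ^ d * oneArmProb d p n := by
  classical
  set C₂ : ℝ := 2 * d * A * (192 : ℝ) ^ (d - 1) + (5 : ℝ) ^ d * (A * (16 : ℝ) ^ (d - 1) / oneArmProb d p 1 ^ 2) with hC₂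
  set C₁ : ℝ := 2 * d * A' * (48 : ℝ) ^ (d - 1) + (5 : ℝ) ^ d * (A' * (4 : ℝ) ^ (d - 1) / oneArmProb d p 1) with hC₁
  set ρ : ℕ := (R - 1) / 2 with hρ
  have hπ : ∀ m, 0 < oneArmProb d p m := oneArmProb_pos hd p hp
  have hπn : 0 ≤ oneArmProb d p n := (hπ n).le
  have h2n : 1 ≤ 2 * n := by omega
  have hρ2n : ρ ≤ 2 * n := by omega
  have hπρ : oneArmProb d p (2 * n) ≤ oneArmProb d p ρ := DCT16.real_siteToBoundary_antitone p hρ2n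
  have hπ2n : oneArmProb d p (2 * n) ≤ oneArmProb d p n := DCT16.real_siteToBoundary_antitone p (by omega)
  have hd0 : (0 : ℝ) < d := by exact_mod_cast (by omega : 0 < d)
  have hC₂0 : 0 ≤ C₂ := by positivity
  have hC₁0 : 0 ≤ C₁ := by positivity
  -- pointwise bound
  have hpt : ∀ a : Site d, oneArmProb d p ((Site.supNorm (a - b) - 1) / 2) *
        (oneArmProb d p ((min (Site.supNorm (a - b)) R - 1) / 2) / oneArmProb d p ρ) ≤
      oneArmProb d p ((Site.supNorm (a - b) - 1) / 2) ^ 2 / oneArmProb d p ρ +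
        oneArmProb d p ((Site.supNorm (a - b) - 1) / 2) := by
    intro a
    set k : ℕ := (Site.supNorm (a - b) - 1) / 2 with hk
    have hπk : 0 ≤ oneArmProb d p k := (hπ k).le
    have h1 : 0 ≤ oneArmProb d p k ^ 2 / oneArmProb d p ρ := div_nonneg (sq_nonneg _) (hπ ρ).le
    by_cases hmR : Site.supNorm (a - b) ≤ R
    · rw [min_eq_left hmR]
      calc oneArmProb d p k * (oneArmProb d p k / oneArmProb d p ρ) = oneArmProb d p k ^ 2 / oneArmProb d p ρ := by ring
        _ ≤ oneArmProb d p k ^ 2 / oneArmProb d p ρ + oneArmProb d p k := le_add_of_nonneg_right hπk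
    · rw [min_eq_right (not_le.1 hmR).le, ← hρ, div_self (hπ ρ).ne', mul_one]
      exact le_add_of_nonneg_left h1
  -- the two lattice sums over `Λ(2n)`
  have hsq : ∑ a ∈ box d n, oneArmProb d p ((Site.supNorm (a - b) - 1) / 2) ^ 2 ≤
      C₂ * ((2 * n : ℕ) : ℝ) ^ d * oneArmProb d p (2 * n) ^ 2 := by
    refine le_trans (sum_box_sub_le_sum_box_two_mul hb (g := fun z => oneArmProb d p ((Site.supNorm z - 1) / 2) ^ 2)
      fun z => sq_nonneg _) ?_
    exact sum_sq_oneArmProb_le_of_ratio hd p hA hR1 hπ1 h2n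
  have hlin : ∑ a ∈ box d n, oneArmProb d p ((Site.supNorm (a - b) - 1) / 2) ≤
      C₁ * ((2 * n : ℕ) : ℝ) ^ d * oneArmProb d p (2 * n) := by
    refine le_trans (sum_box_sub_le_sum_box_two_mul hb (g := fun z => oneArmProb d p ((Site.supNorm z - 1) / 2))
      fun z => (hπ _).le) ?_
    exact sum_oneArmProb_le_of_linRatio hd p hA' hRlin hπ1 h2n
  have hcast : ((2 * n : ℕ) : ℝ) ^ d = (2 : ℝ) ^ d * (n : ℝ) ^ d := by push_cast; rw [mul_pow]
  rw [hcast] at hsq hlin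
  -- assemble
  calc ∑ a ∈ box d n, oneArmProb d p ((Site.supNorm (a - b) - 1) / 2) *
          (oneArmProb d p ((min (Site.supNorm (a - b)) R - 1) / 2) / oneArmProb d p ρ)
      ≤ ∑ a ∈ box d n, (oneArmProb d p ((Site.supNorm (a - b) - 1) / 2) ^ 2 / oneArmProb d p ρ +
          oneArmProb d p ((Site.supNorm (a - b) - 1) / 2)) := Finset.sum_le_sum fun a _ => hpt a
    _ = (∑ a ∈ box d n, oneArmProb d p ((Site.supNorm (a - b) - 1) / 2) ^ 2) / oneArmProb d p ρ +
          ∑ a ∈ box d n, oneArmProb d p ((Site.supNorm (a - b) - 1) / 2) := by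
        rw [Finset.sum_add_distrib, Finset.sum_div]
    _ ≤ C₂ * ((2 : ℝ) ^ d * (n : ℝ) ^ d) * oneArmProb d p (2 * n) ^ 2 / oneArmProb d p ρ +
          C₁ * ((2 : ℝ) ^ d * (n : ℝ) ^ d) * oneArmProb d p (2 * n) :=
        add_le_add (div_le_div_of_nonneg_right hsq (hπ ρ).le) hlin
    _ ≤ C₂ * ((2 : ℝ) ^ d * (n : ℝ) ^ d) * oneArmProb d p n + C₁ * ((2 : ℝ) ^ d * (n : ℝ) ^ d) * oneArmProb d p n := by
        refine add_le_add ?_ (mul_le_mul_of_nonneg_left hπ2n (by positivity))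
        rw [div_le_iff₀ (hπ ρ)]
        have h3 : oneArmProb d p (2 * n) ^ 2 ≤ oneArmProb d p n * oneArmProb d p ρ := by
          rw [sq]; exact mul_le_mul hπ2n hπρ (hπ _).le hπn
        calc C₂ * ((2 : ℝ) ^ d * (n : ℝ) ^ d) * oneArmProb d p (2 * n) ^ 2
            ≤ C₂ * ((2 : ℝ) ^ d * (n : ℝ) ^ d) * (oneArmProb d p n * oneArmProb d p ρ) :=
              mul_le_mul_of_nonneg_left h3 (by positivity)
          _ = C₂ * ((2 : ℝ) ^ d * (n : ℝ) ^ d) * oneArmProb d p n * oneArmProb d p ρ := by ring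
    _ = (2 : ℝ) ^ d * (C₂ + C₁) * (n : ℝ) ^ d * oneArmProb d p n := by ring

/-! ## §3 One more point costs a factor `s(n) = n^d π(n)` -/

/-- **ONE MORE POINT, `|S| ≥ 2`** (every `p > 0`, `d ≥ 1`, (R1), (R_lin), (R2), `π(1) > 0`): for `n ≥ 1` and `S ⊆ Λ(n)` with `|S| ≥ 2`,
`Σ_{a ∈ Λ(n)} W(S ∪ {a}) ≤ W(S) · |S| · (1 + (B/π(1))^{|S|−1} · K · n^d π(n))` — the insertion inequality of part II summed with §2.
[cite: Kesten1986, Thm. (8), (51)–(53)] -/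
theorem sum_prod_insert_le_mul (hd : 1 ≤ d) (p : unitInterval) (hp : 0 < (p : ℝ)) {A A' B : ℝ} (hA : 0 ≤ A) (hA' : 0 ≤ A')
    (hR1 : ∀ j n : ℕ, 1 ≤ j → j ≤ n →
      oneArmProb d p j ^ 2 * ((j : ℝ) / (16 * n)) ^ (d - 1) ≤ A * oneArmProb d p n ^ 2)
    (hRlin : ∀ j n : ℕ, 1 ≤ j → j ≤ n →
      oneArmProb d p j * ((j : ℝ) / (4 * n)) ^ (d - 1) ≤ A' * oneArmProb d p n)
    (hR2 : ∀ j n : ℕ, 1 ≤ j → j ≤ n → n ≤ 8 * j → oneArmProb d p j ≤ B * oneArmProb d p n)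
    (hπ1 : 0 < oneArmProb d p 1) {n : ℕ} (hn : 1 ≤ n) {S : Finset (Site d)} (hS : 1 < S.card) (hSn : S ⊆ box d n) :
    ∑ a ∈ box d n, ∏ x ∈ insert a S, oneArmProb d p ((((Finset.erase (insert a S) (x)).inf (fun w => ((Site.supNorm ((x) - w) : ℕ) : ℕ∞))).toNat - 1) / 2) ≤
      (∏ x ∈ S, oneArmProb d p ((((Finset.erase (S) (x)).inf (fun w => ((Site.supNorm ((x) - w) : ℕ) : ℕ∞))).toNat - 1) / 2)) * (S.card * (1 + (B / oneArmProb d p 1) ^ (S.card - 1) *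
        ((2 : ℝ) ^ d * ((2 * d * A * (192 : ℝ) ^ (d - 1) + (5 : ℝ) ^ d * (A * (16 : ℝ) ^ (d - 1) / oneArmProb d p 1 ^ 2)) +
          (2 * d * A' * (48 : ℝ) ^ (d - 1) + (5 : ℝ) ^ d * (A' * (4 : ℝ) ^ (d - 1) / oneArmProb d p 1))) *
          (n : ℝ) ^ d * oneArmProb d p n))) := by
  classical
  set K : ℝ := (2 : ℝ) ^ d * ((2 * d * A * (192 : ℝ) ^ (d - 1) + (5 : ℝ) ^ d * (A * (16 : ℝ) ^ (d - 1) / oneArmProb d p 1 ^ 2)) +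
    (2 * d * A' * (48 : ℝ) ^ (d - 1) + (5 : ℝ) ^ d * (A' * (4 : ℝ) ^ (d - 1) / oneArmProb d p 1))) with hK
  set D : ℝ := B / oneArmProb d p 1 with hDdef
  have hf : ∀ m : ℕ, 0 < (fun m : ℕ => oneArmProb d p ((m - 1) / 2)) m := fun m => oneArmProb_pos hd p hp _
  have hD : ∀ u v : ℕ, u ≤ v → v ≤ 2 * u →
      (fun m : ℕ => oneArmProb d p ((m - 1) / 2)) u ≤ D * (fun m : ℕ => oneArmProb d p ((m - 1) / 2)) v :=
    fun u v huv hvu => oneArmProb_halfRadius_doubling p hR2 hπ1 huv hvu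
  have h := sum_prod_insert_nnd_le hf hD hS (box d n)
  beta_reduce at h
  refine h.trans ?_
  have hW : 0 ≤ ∏ x ∈ S, oneArmProb d p ((((Finset.erase (S) (x)).inf (fun w => ((Site.supNorm ((x) - w) : ℕ) : ℕ∞))).toNat - 1) / 2) := Finset.prod_nonneg fun x _ => measureReal_nonneg
  refine mul_le_mul_of_nonneg_left ?_ hW
  -- the inner sums, one for each `b ∈ S`
  have hinner : ∀ b ∈ S, ∑ a ∈ box d n, oneArmProb d p ((Site.supNorm (a - b) - 1) / 2) *
      (oneArmProb d p ((min (Site.supNorm (a - b)) ((Finset.erase (S) (b)).inf (fun w => ((Site.supNorm ((b) - w) : ℕ) : ℕ∞))).toNat - 1) / 2) / oneArmProb d p ((((Finset.erase (S) (b)).inf (fun w => ((Site.supNorm ((b) - w) : ℕ) : ℕ∞))).toNat - 1) / 2)) ≤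
      K * (n : ℝ) ^ d * oneArmProb d p n := by
    intro b hb
    have hR : ((Finset.erase (S) (b)).inf (fun w => ((Site.supNorm ((b) - w) : ℕ) : ℕ∞))).toNat ≤ 4 * n + 1 :=
      (nnd_le_two_mul_of_subset_box hSn hb (erase_nonempty_of_one_lt_card hS b)).trans (by omega)
    exact sum_pairWeight_le hd p hp hA hA' hR1 hRlin hπ1 hn (hSn hb) hR
  have hsum : ∑ b ∈ S, ∑ a ∈ box d n, oneArmProb d p ((Site.supNorm (a - b) - 1) / 2) *
      (oneArmProb d p ((min (Site.supNorm (a - b)) ((Finset.erase (S) (b)).inf (fun w => ((Site.supNorm ((b) - w) : ℕ) : ℕ∞))).toNat - 1) / 2) / oneArmProb d p ((((Finset.erase (S) (b)).inf (fun w => ((Site.supNorm ((b) - w) : ℕ) : ℕ∞))).toNat - 1) / 2)) ≤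
      S.card * (K * (n : ℝ) ^ d * oneArmProb d p n) := by
    have h := Finset.sum_le_card_nsmul S _ _ hinner
    rwa [nsmul_eq_mul] at h
  have hB1 : 1 ≤ B := by
    have h1 := hR2 1 1 le_rfl le_rfl (by norm_num)
    nlinarith
  have hD0 : 0 ≤ D := div_nonneg (by linarith) hπ1.le
  calc (S.card : ℝ) + D ^ (S.card - 1) * ∑ b ∈ S, ∑ a ∈ box d n, oneArmProb d p ((Site.supNorm (a - b) - 1) / 2) *
          (oneArmProb d p ((min (Site.supNorm (a - b)) ((Finset.erase (S) (b)).inf (fun w => ((Site.supNorm ((b) - w) : ℕ) : ℕ∞))).toNat - 1) / 2) / oneArmProb d p ((((Finset.erase (S) (b)).inf (fun w => ((Site.supNorm ((b) - w) : ℕ) : ℕ∞))).toNat - 1) / 2))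
      ≤ S.card + D ^ (S.card - 1) * (S.card * (K * (n : ℝ) ^ d * oneArmProb d p n)) :=
        add_le_add le_rfl (mul_le_mul_of_nonneg_left hsum (pow_nonneg hD0 _))
    _ = S.card * (1 + D ^ (S.card - 1) * (K * (n : ℝ) ^ d * oneArmProb d p n)) := by ring

/-- **ONE MORE POINT, from the singleton `{0}`** (every `p`, `d ≥ 1`, (R1), `π(1) > 0`): for `n ≥ 1`,
`Σ_{a ∈ Λ(n)} W({0, a}) ≤ (A·16^{d−1}/π(1)² + C₂) · n^d · π(n)²` — the term `a = 0` is `W({0}) = 1 ≤ A16^{d−1}n^dπ(n)²/π(1)²`, the others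
are `π(⌊(‖a‖−1)/2⌋)²` (gen 19's lattice sum).  This is the case `t = 1` of the moment bounds: `Σ_a τ(0,a) ≤ C n^d π(n)²`.
[cite: Kesten1986, Thm. (8), (47)] -/
theorem sum_prod_insert_singleton_le (hd : 1 ≤ d) (p : unitInterval) {A : ℝ} (hA : 0 ≤ A)
    (hR1 : ∀ j n : ℕ, 1 ≤ j → j ≤ n →
      oneArmProb d p j ^ 2 * ((j : ℝ) / (16 * n)) ^ (d - 1) ≤ A * oneArmProb d p n ^ 2)
    (hπ1 : 0 < oneArmProb d p 1) {n : ℕ} (hn : 1 ≤ n) :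
    ∑ a ∈ box d n, ∏ x ∈ insert a ({0} : Finset (Site d)), oneArmProb d p ((((Finset.erase (insert a {0}) (x)).inf (fun w => ((Site.supNorm ((x) - w) : ℕ) : ℕ∞))).toNat - 1) / 2) ≤
      (A * (16 : ℝ) ^ (d - 1) / oneArmProb d p 1 ^ 2 +
        (2 * d * A * (192 : ℝ) ^ (d - 1) + (5 : ℝ) ^ d * (A * (16 : ℝ) ^ (d - 1) / oneArmProb d p 1 ^ 2))) *
        (n : ℝ) ^ d * oneArmProb d p n ^ 2 := by
  classical
  rw [← Finset.add_sum_erase (box d n) _ (zero_mem_box d n)]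
  -- the term `a = 0`
  have h0 : ∏ x ∈ insert (0 : Site d) ({0} : Finset (Site d)), oneArmProb d p ((((Finset.erase (insert (0 : Site d) {0}) (x)).inf (fun w => ((Site.supNorm ((x) - w) : ℕ) : ℕ∞))).toNat - 1) / 2) = 1 := by
    rw [Finset.insert_eq_of_mem (Finset.mem_singleton_self _), Finset.prod_singleton, nnd_singleton]
    exact oneArmProb_zero hd p
  -- the terms `a ≠ 0`
  have hne : ∀ a ∈ (box d n).erase 0, ∏ x ∈ insert a ({0} : Finset (Site d)), oneArmProb d p ((((Finset.erase (insert a {0}) (x)).inf (fun w => ((Site.supNorm ((x) - w) : ℕ) : ℕ∞))).toNat - 1) / 2) =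
      oneArmProb d p ((Site.supNorm a - 1) / 2) ^ 2 := by
    intro a ha
    have ha0 : a ≠ 0 := (Finset.mem_erase.1 ha).1
    have ha' : a ∉ ({0} : Finset (Site d)) := fun h => ha0 (Finset.mem_singleton.1 h)
    rw [Finset.prod_insert ha', Finset.prod_singleton, nnd_pair_left ha0, nnd_pair_right ha0, sub_zero, sq]
  rw [h0, Finset.sum_congr rfl hne]
  have h1 := one_le_of_ratio p hR1 hπ1 hn
  have h2 : ∑ a ∈ (box d n).erase 0, oneArmProb d p ((Site.supNorm a - 1) / 2) ^ 2 ≤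
      (2 * d * A * (192 : ℝ) ^ (d - 1) + (5 : ℝ) ^ d * (A * (16 : ℝ) ^ (d - 1) / oneArmProb d p 1 ^ 2)) *
        (n : ℝ) ^ d * oneArmProb d p n ^ 2 :=
    (Finset.sum_le_sum_of_subset_of_nonneg (Finset.erase_subset _ _) fun a _ _ => sq_nonneg _).trans
      (sum_sq_oneArmProb_le_of_ratio hd p hA hR1 hπ1 hn)
  calc (1 : ℝ) + ∑ a ∈ (box d n).erase 0, oneArmProb d p ((Site.supNorm a - 1) / 2) ^ 2
      ≤ A * (16 : ℝ) ^ (d - 1) / oneArmProb d p 1 ^ 2 * (n : ℝ) ^ d * oneArmProb d p n ^ 2 +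
        (2 * d * A * (192 : ℝ) ^ (d - 1) + (5 : ℝ) ^ d * (A * (16 : ℝ) ^ (d - 1) / oneArmProb d p 1 ^ 2)) *
        (n : ℝ) ^ d * oneArmProb d p n ^ 2 := add_le_add h1 h2
    _ = _ := by ring

end Rsw3

end Summit.CriticalPhenomena.PercolationContinuityZ3.Theorems
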